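import Literature.AnabelianGeometry.EtaleTheta.FrobenioidThetaDivisorSupport
import Literature.AnabelianGeometry.EtaleTheta.Discharge.Sec5Prop53
import Mathlib.Algebra.Group.TypeTags.Basic

/-!
# [EtTh] §5, Proposition 5.3 (v) from the printed adjacency criterion (pp. 325–327 / PDF pp. 99–101)

Mochizuki, *The étale theta function …*, Publ. RIMS **45** (2009)
[cite: MochizukiEtTh2009, Prop 5.3 (v) p.325 (PDF p.99); proof p.326–327 (PDF pp.100–101)].  Seat abc-iut-L2-d4 (merge
row W3-L2-03, proof companion); PROOF-ONLY over this seat's `FrobenioidThetaDivisorSupport.lean` (`DivisorSupportData`,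
`AdjacencyCriterion`) and `Discharge/Sec5Prop53.lean` (`preservesNcspLabels_of_adjacency`, `apply_componentIso_eq`).

Print (p.327 (PDF p.101)): "To verify the preservation of (v), it suffices to show that the relation of adjacency …
between elements `𝔭, 𝔮 ∈ Φ(A_⊚)^ncsp` is preserved. But this follows … by observing that if `a ∈ 𝔭`, `b ∈ 𝔮` correspond
via the natural isomorphisms of (ii), then `𝔭, 𝔮` are adjacent (respectively, not adjacent) if and only if every
cuspidally minimal `c ∈ Φ(A_⊚)^gp` which is linearly equivalent to `a + b` has support of cardinality `4` (respectively,
`5` or `6`)."  This file PROVES that implication: every notion in the criterion (linear equivalence, supports and their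
cardinalities, cuspidality, cuspidal minimality, the correspondence of (ii)) is TRANSPORTED by the automorphism
`Ψ^Φ_{A_⊚}` of `Φ(A_⊚)` once `Ψ^Φ_{A_⊚}` preserves cuspidal primes (Prop. 5.3 (i), Cor. 3.8 (iii)) and — extended to
`Φ(A_⊚)^gp` — the principal elements ("the image of the birational function monoid", [FrdI] Thm. 4.9 / Cor. 4.10: the
named input F1-Ψ of the W3-L2-03 ruling); the compatibility of `Ψ^Φ_{A_⊚}` with the orders `ord_𝔭` (hence with supports)
is DERIVED from the factorization data alone (`ordOf_map`: prime log-divisors go to prime log-divisors, and every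
element of `Φ(A_⊚)` has a positive multiple in the span of the prime log-divisors).  Hence
(`preservesNcspLabels_of_adjacencyCriterion`) **Prop. 5.3 (v) holds modulo (i), F1-Ψ and the printed criterion**
(`AdjacencyCriterion`, itself to be proved from the intersection theory of the special fibre — GAP G-L2d4-2).
HONEST FRAMING: kernel-checked implications; the criterion and (i) enter as hypotheses; typed ≠ discharged; no side
taken on anything downstream. -/

namespace Literature.AnabelianGeometry.EtaleTheta

open CategoryTheory
open Literature.AlgebraicGeometry.Frobenioids

universe w v v' u u'

namespace FrobenioidThetaDivisors

namespace DivisorSupportData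

variable {C : Type u} [Category.{v} C] {D : Type u'} [Category.{v'} D] {𝔉 : ThetaFrobenioid.{w} C D}
  {𝔓 : DivisorPrimeData 𝔉} (𝔖 : DivisorSupportData 𝔓)

/-! ### Prime log-divisors generate the primary components -/

/-- `factor(gen_𝔭 ^ n) = n·[𝔭]`. [cite: MochizukiEtTh2009, Prop 5.3 p.325 (PDF p.99)] -/
theorem factor_gen_pow (𝔭 : Primes 𝔉.PhiAcirc) (n : ℕ) :
    𝔖.factor (𝔖.gen 𝔭 ^ n) = Multiplicative.ofAdd (Finsupp.single 𝔭 (n : ℚ)) := by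
  induction n with
  | zero => rw [pow_zero, map_one, Nat.cast_zero, Finsupp.single_zero]; rfl
  | succ n ih => rw [pow_succ, map_mul, ih, 𝔖.factor_gen, ← ofAdd_add, ← Finsupp.single_add, Nat.cast_succ]

/-- The `𝔮`-coordinate of the factorization is the order at `𝔮`. [cite: MochizukiEtTh2009, Prop 5.3 proof p.326 (PDF p.100)] -/
theorem toAdd_factor_apply (x : 𝔉.PhiAcirc) (𝔮 : Primes 𝔉.PhiAcirc) :
    Multiplicative.toAdd (𝔖.factor x) 𝔮 = Multiplicative.toAdd (ordOf 𝔖.factor 𝔮 x) := rfl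

/-- The order of a product of powers of prime log-divisors: `ord_𝔮(∏ gen_𝔭^{k_𝔭}) = k_𝔮`.
[cite: MochizukiEtTh2009, Prop 5.3 p.325 (PDF p.99)] -/
theorem ordOf_prod_gen_pow (g : Primes 𝔉.PhiAcirc → Primes 𝔉.PhiAcirc) (hg : Function.Injective g)
    (e : 𝔉.PhiAcirc →* 𝔉.PhiAcirc) (he : ∀ 𝔭, e (𝔖.gen 𝔭) = 𝔖.gen (g 𝔭)) (k : Primes 𝔉.PhiAcirc →₀ ℕ)
    (𝔮 : Primes 𝔉.PhiAcirc) :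
    ordOf 𝔖.factor (g 𝔮) (e (k.prod fun 𝔭 n => 𝔖.gen 𝔭 ^ n)) = Multiplicative.ofAdd ((k 𝔮 : ℕ) : ℚ) := by
  classical
  rw [map_finsuppProd, map_finsuppProd]
  simp_rw [map_pow, he]
  rw [Finsupp.prod, Finset.prod_eq_single 𝔮]
  · rw [𝔖.ordOf_gen_self, ← ofAdd_nsmul, nsmul_eq_mul, mul_one]
  · intro 𝔭 _ hne
    rw [𝔖.ordOf_gen_of_ne (fun h => hne (hg h)), one_pow]
  · intro h𝔮
    rw [Finsupp.notMem_support_iff.mp h𝔮, pow_zero]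

/-- A primary element of `𝔭` is a positive power of the prime log-divisor `gen_𝔭` (`Φ(A_⊚)_𝔭 ≅ ℤ_{≥0}`, monoid type
`ℤ`).  [cite: MochizukiEtTh2009, Prop 5.3 p.325 (PDF p.99)] -/
theorem eq_gen_pow_of_mem_carrier {𝔭 : Primes 𝔉.PhiAcirc} {a : 𝔉.PhiAcirc} (ha : a ∈ 𝔭.carrier) :
    ∃ n : ℕ, 0 < n ∧ a = 𝔖.gen 𝔭 ^ n := by
  obtain ⟨n, hn, hfa⟩ := (𝔖.factor_carrier 𝔭 a).mp ha
  exact ⟨n, hn, 𝔖.factor_injective (by rw [hfa, factor_gen_pow])⟩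

/-- Positive powers of `gen_𝔭` are primary elements of `𝔭`. [cite: MochizukiEtTh2009, Prop 5.3 p.325 (PDF p.99)] -/
theorem gen_pow_mem_carrier (𝔭 : Primes 𝔉.PhiAcirc) {n : ℕ} (hn : 0 < n) : 𝔖.gen 𝔭 ^ n ∈ 𝔭.carrier :=
  (𝔖.factor_carrier 𝔭 _).mpr ⟨n, hn, 𝔖.factor_gen_pow 𝔭 n⟩

/-- **A monoid automorphism of `Φ(A_⊚)` maps prime log-divisors to prime log-divisors**: `ψ(gen_𝔭) = gen_{ψ𝔭}` (it maps
the primary component `Φ_𝔭 ≅ ℤ_{≥0}` isomorphically onto `Φ_{ψ𝔭}`, hence generator to generator — "identifying the elements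
on each side that arise from [scheme-theoretic] prime log-divisors", p.325 (PDF p.99)).
[cite: MochizukiEtTh2009, Prop 5.3 p.325 (PDF p.99)] -/
theorem map_gen (ψ : 𝔉.PhiAcirc ≃* 𝔉.PhiAcirc) (𝔭 : Primes 𝔉.PhiAcirc) :
    ψ (𝔖.gen 𝔭) = 𝔖.gen (Primes.congr ψ 𝔭) := by
  have h1 : ψ (𝔖.gen 𝔭) ∈ (Primes.congr ψ 𝔭).carrier := by
    rw [Primes.carrier_congr]; exact ⟨_, 𝔖.gen_mem_carrier 𝔭, rfl⟩
  obtain ⟨n₁, hn₁, h₁⟩ := 𝔖.eq_gen_pow_of_mem_carrier h1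
  have h2 : ψ.symm (𝔖.gen (Primes.congr ψ 𝔭)) ∈ 𝔭.carrier :=
    (Primes.mem_carrier_congr_iff ψ 𝔭 _).mp (𝔖.gen_mem_carrier _)
  obtain ⟨n₂, hn₂, h₂⟩ := 𝔖.eq_gen_pow_of_mem_carrier h2
  have h3 : 𝔖.gen (Primes.congr ψ 𝔭) = 𝔖.gen (Primes.congr ψ 𝔭) ^ (n₁ * n₂) := by
    calc 𝔖.gen (Primes.congr ψ 𝔭) = ψ (ψ.symm (𝔖.gen (Primes.congr ψ 𝔭))) := (ψ.apply_symm_apply _).symm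
      _ = ψ (𝔖.gen 𝔭 ^ n₂) := by rw [h₂]
      _ = ψ (𝔖.gen 𝔭) ^ n₂ := map_pow _ _ _
      _ = 𝔖.gen (Primes.congr ψ 𝔭) ^ (n₁ * n₂) := by rw [h₁, ← pow_mul]
  have h4 : ((n₁ * n₂ : ℕ) : ℚ) = 1 := by
    have := congrArg (fun x => Multiplicative.toAdd (𝔖.factor x) (Primes.congr ψ 𝔭)) h3
    simp only [factor_gen_pow, 𝔖.factor_gen, toAdd_ofAdd, Finsupp.single_eq_same] at this
    exact this.symm
  have h5 : n₁ * n₂ = 1 := by exact_mod_cast h4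
  rw [h₁, Nat.eq_one_of_mul_eq_one_right h5, pow_one]

/-- **Every element of `Φ(A_⊚)` has a positive multiple in the span of the prime log-divisors** (the coordinates of
the factorization homomorphism are non-negative rationals with a common denominator: `q·a = Σ_𝔭 k_𝔭·gen_𝔭` — the
components of the special fibre are `ℚ`-Cartier, Prop. 3.2 (i) proof p.297 (PDF p.71) "`e·D`, `e·E` are Cartier").
[cite: MochizukiEtTh2009, Prop 3.2 (i) p.297 (PDF p.71); Prop 5.3 p.325 (PDF p.99)] -/
theorem exists_pow_eq_prod (a : 𝔉.PhiAcirc) :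
    ∃ q : ℕ, 0 < q ∧ ∃ k : Primes 𝔉.PhiAcirc →₀ ℕ, a ^ q = k.prod fun 𝔭 n => 𝔖.gen 𝔭 ^ n := by
  classical
  set f : Primes 𝔉.PhiAcirc →₀ ℚ := Multiplicative.toAdd (𝔖.factor a) with hf
  have hf0 : ∀ 𝔭, 0 ≤ f 𝔭 := fun 𝔭 => 𝔖.factor_nonneg a 𝔭
  -- a common denominator of the finitely many coordinates
  set q : ℕ := f.support.prod fun 𝔭 => (f 𝔭).den with hq
  have hqpos : 0 < q := Finset.prod_pos fun 𝔭 _ => (f 𝔭).den_pos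
  have hint : ∀ 𝔭, ∃ n : ℕ, (n : ℚ) = q * f 𝔭 := by
    intro 𝔭
    by_cases h𝔭 : 𝔭 ∈ f.support
    · obtain ⟨m, hm⟩ : (f 𝔭).den ∣ q := Finset.dvd_prod_of_mem (fun 𝔭 => (f 𝔭).den) h𝔭
      have hnum : 0 ≤ (f 𝔭).num := Rat.num_nonneg.mpr (hf0 𝔭)
      refine ⟨m * (f 𝔭).num.toNat, ?_⟩
      have hcast : (((f 𝔭).num.toNat : ℕ) : ℚ) = ((f 𝔭).num : ℚ) := by
        rw [← Int.cast_natCast, Int.toNat_of_nonneg hnum]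
      rw [hm, Nat.cast_mul, Nat.cast_mul, hcast, ← Rat.den_mul_eq_num (f 𝔭)]
      ring
    · exact ⟨0, by rw [Finsupp.notMem_support_iff.mp h𝔭, mul_zero, Nat.cast_zero]⟩
  choose n hn using hint
  have hn0 : ∀ 𝔭, n 𝔭 ≠ 0 → 𝔭 ∈ f.support := by
    intro 𝔭 h𝔭
    by_contra hns
    apply h𝔭
    have h0 : f 𝔭 = 0 := Finsupp.notMem_support_iff.mp hns
    have := hn 𝔭
    rw [h0, mul_zero] at this
    exact_mod_cast this
  let k : Primes 𝔉.PhiAcirc →₀ ℕ := Finsupp.onFinset f.support n hn0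
  refine ⟨q, hqpos, k, 𝔖.factor_injective ?_⟩
  apply Multiplicative.toAdd.injective
  ext 𝔮
  have hk' : ordOf 𝔖.factor 𝔮 (k.prod fun 𝔭 n => 𝔖.gen 𝔭 ^ n) = Multiplicative.ofAdd ((k 𝔮 : ℕ) : ℚ) :=
    𝔖.ordOf_prod_gen_pow id Function.injective_id (MonoidHom.id _) (fun _ => rfl) k 𝔮
  rw [toAdd_factor_apply, toAdd_factor_apply, map_pow, toAdd_pow, nsmul_eq_mul, hk', toAdd_ofAdd]
  change (q : ℚ) * f 𝔮 = ((k 𝔮 : ℕ) : ℚ)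
  exact (hn 𝔮).symm

/-- **`Ψ^Φ_{A_⊚}` is compatible with the orders**: `ord_{ψ𝔭}(ψ a) = ord_𝔭(a)` for every monoid automorphism `ψ` of
`Φ(A_⊚)` (from `map_gen` and `exists_pow_eq_prod`; the orders are `ℚ`-valued, so a `q`-th power may be cancelled).
[cite: MochizukiEtTh2009, Prop 5.3 p.325 (PDF p.99)] -/
theorem ordOf_map (ψ : 𝔉.PhiAcirc ≃* 𝔉.PhiAcirc) (𝔭 : Primes 𝔉.PhiAcirc) (a : 𝔉.PhiAcirc) :
    ordOf 𝔖.factor (Primes.congr ψ 𝔭) (ψ a) = ordOf 𝔖.factor 𝔭 a := by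
  obtain ⟨q, hq, k, hk⟩ := 𝔖.exists_pow_eq_prod a
  have h1 : ordOf 𝔖.factor (Primes.congr ψ 𝔭) (ψ a) ^ q = Multiplicative.ofAdd ((k 𝔭 : ℕ) : ℚ) := by
    rw [← map_pow, ← map_pow, hk]
    exact 𝔖.ordOf_prod_gen_pow (Primes.congr ψ) (Primes.congr ψ).injective ψ.toMonoidHom (𝔖.map_gen ψ) k 𝔭
  have h2 : ordOf 𝔖.factor 𝔭 a ^ q = Multiplicative.ofAdd ((k 𝔭 : ℕ) : ℚ) := by
    rw [← map_pow, hk]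
    exact 𝔖.ordOf_prod_gen_pow id Function.injective_id (MonoidHom.id _) (fun _ => rfl) k 𝔭
  -- cancel the `q`-th power in `Multiplicative ℚ`
  apply Multiplicative.toAdd.injective
  have := congrArg Multiplicative.toAdd (h1.trans h2.symm)
  rw [toAdd_pow, toAdd_pow] at this
  exact (nsmul_right_injective hq.ne') this

/-! ### Transport of supports, linear equivalence and cuspidal minimality along `Ψ^Φ_{A_⊚}` on `Φ(A_⊚)^gp` -/

/-- Homomorphisms out of the Grothendieck group that agree on `Φ(A_⊚)` are equal (universal property).
[cite: MochizukiEtTh2009, Prop 5.3 (vi) p.326 (PDF p.100)] -/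
theorem gpHom_ext {M : Type w} [CommMonoid M] {G : Type*} [CommGroup G]
    {f g : Algebra.GrothendieckGroup M →* G}
    (h : ∀ a, f (Algebra.GrothendieckGroup.of a) = g (Algebra.GrothendieckGroup.of a)) : f = g := by
  rw [← Algebra.GrothendieckGroup.lift.apply_symm_apply f, ← Algebra.GrothendieckGroup.lift.apply_symm_apply g]
  congr 1
  rw [Algebra.GrothendieckGroup.lift_symm_apply, Algebra.GrothendieckGroup.lift_symm_apply]
  ext a
  exact h a

variable (ψ : 𝔉.PhiAcirc ≃* 𝔉.PhiAcirc)

/-- The orders on `Φ(A_⊚)^gp` are transported: `ord_{ψ𝔭}(ψ^gp x) = ord_𝔭(x)`.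
[cite: MochizukiEtTh2009, Prop 5.3 proof p.326 (PDF p.100)] -/
theorem ordGp_gpMap (𝔭 : Primes 𝔉.PhiAcirc) (x : Algebra.GrothendieckGroup 𝔉.PhiAcirc) :
    𝔖.ordGp (Primes.congr ψ 𝔭) (ThetaFrobenioid.gpMap ψ.toMonoidHom x) = 𝔖.ordGp 𝔭 x := by
  have : (𝔖.ordGp (Primes.congr ψ 𝔭)).comp (ThetaFrobenioid.gpMap ψ.toMonoidHom) = 𝔖.ordGp 𝔭 :=
    gpHom_ext fun a => by
      rw [MonoidHom.comp_apply, ThetaFrobenioid.gpMap_of, ordGp_of, MulEquiv.coe_toMonoidHom, ordGp_of]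
      exact 𝔖.ordOf_map ψ 𝔭 a
  exact DFunLike.congr_fun this x

/-- Supports are transported: `supp(ψ^gp x) = ψ(supp x)`. [cite: MochizukiEtTh2009, Prop 5.3 proof p.326 (PDF p.100)] -/
theorem supp_gpMap (x : Algebra.GrothendieckGroup 𝔉.PhiAcirc) :
    suppOf 𝔖.factor (ThetaFrobenioid.gpMap ψ.toMonoidHom x) = Primes.congr ψ '' suppOf 𝔖.factor x := by
  ext 𝔮
  constructor
  · intro h
    refine ⟨Primes.congr ψ.symm 𝔮, ?_, Primes.congr_apply_congr_symm ψ 𝔮⟩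
    change 𝔖.ordGp (Primes.congr ψ.symm 𝔮) x ≠ 1
    rw [← 𝔖.ordGp_gpMap ψ (Primes.congr ψ.symm 𝔮) x, Primes.congr_apply_congr_symm]
    exact h
  · rintro ⟨𝔭, h𝔭, rfl⟩
    change 𝔖.ordGp (Primes.congr ψ 𝔭) _ ≠ 1
    rw [𝔖.ordGp_gpMap]
    exact h𝔭

/-- Cardinalities of supports are preserved. [cite: MochizukiEtTh2009, Prop 5.3 proof p.326 (PDF p.100)] -/
theorem ncard_supp_gpMap (x : Algebra.GrothendieckGroup 𝔉.PhiAcirc) :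
    (suppOf 𝔖.factor (ThetaFrobenioid.gpMap ψ.toMonoidHom x)).ncard = (suppOf 𝔖.factor x).ncard := by
  rw [supp_gpMap, Set.ncard_image_of_injective _ (Primes.congr ψ).injective]

/-- Finiteness of supports is preserved. [cite: MochizukiEtTh2009, Prop 5.3 proof p.326 (PDF p.100)] -/
theorem finite_supp_gpMap_iff (x : Algebra.GrothendieckGroup 𝔉.PhiAcirc) :
    (suppOf 𝔖.factor (ThetaFrobenioid.gpMap ψ.toMonoidHom x)).Finite ↔ (suppOf 𝔖.factor x).Finite := by
  rw [supp_gpMap]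
  exact Set.finite_image_iff (Primes.congr ψ).injective.injOn

/-- Linear equivalence is transported, given that `(Ψ^Φ_{A_⊚})^gp` preserves the principal elements ("the image of
the birational function monoid" — [FrdI] Thm. 4.9 / Cor. 4.10, the named input F1-Ψ).
[cite: MochizukiEtTh2009, Prop 5.3 proof p.326 (PDF p.100)] -/
theorem linEquiv_gpMap_iff
    (hP : ∀ x, ThetaFrobenioid.gpMap ψ.toMonoidHom x ∈ 𝔖.principal ↔ x ∈ 𝔖.principal)
    (x y : Algebra.GrothendieckGroup 𝔉.PhiAcirc) :
    𝔖.LinEquiv (ThetaFrobenioid.gpMap ψ.toMonoidHom x) (ThetaFrobenioid.gpMap ψ.toMonoidHom y) ↔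
      𝔖.LinEquiv x y := by
  change _ ∈ 𝔖.principal ↔ _ ∈ 𝔖.principal
  rw [← map_inv, ← map_mul, hP]

/-- Cuspidality of elements of `Φ(A_⊚)^gp` is transported, given Prop. 5.3 (i) on primes.
[cite: MochizukiEtTh2009, Prop 5.3 (i) p.325 (PDF p.99)] -/
theorem isCuspidalGp_gpMap_iff (hc : ∀ 𝔭, 𝔓.IsCuspidal (Primes.congr ψ 𝔭) ↔ 𝔓.IsCuspidal 𝔭)
    (x : Algebra.GrothendieckGroup 𝔉.PhiAcirc) :
    IsCuspidalGpOf 𝔓 𝔖.factor (ThetaFrobenioid.gpMap ψ.toMonoidHom x) ↔ IsCuspidalGpOf 𝔓 𝔖.factor x := by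
  change (∀ 𝔭 ∈ suppOf 𝔖.factor (ThetaFrobenioid.gpMap ψ.toMonoidHom x), 𝔓.IsCuspidal 𝔭) ↔
    ∀ 𝔭 ∈ suppOf 𝔖.factor x, 𝔓.IsCuspidal 𝔭
  rw [supp_gpMap, Set.forall_mem_image]
  exact forall₂_congr fun 𝔭 _ => hc 𝔭

/-- `(ψ⁻¹)^gp` is a right inverse of `ψ^gp`. [cite: MochizukiEtTh2009, Prop 5.3 (vi) p.326 (PDF p.100)] -/
theorem gpMap_gpMap_symm (y : Algebra.GrothendieckGroup 𝔉.PhiAcirc) :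
    ThetaFrobenioid.gpMap ψ.toMonoidHom (ThetaFrobenioid.gpMap ψ.symm.toMonoidHom y) = y := by
  have : (ThetaFrobenioid.gpMap ψ.toMonoidHom).comp (ThetaFrobenioid.gpMap ψ.symm.toMonoidHom) =
      MonoidHom.id _ :=
    gpHom_ext fun a => by
      rw [MonoidHom.comp_apply, ThetaFrobenioid.gpMap_of, ThetaFrobenioid.gpMap_of, MonoidHom.id_apply,
        MulEquiv.coe_toMonoidHom, MulEquiv.coe_toMonoidHom, MulEquiv.apply_symm_apply]
  exact DFunLike.congr_fun this y

/-- **Cuspidal minimality is transported** (all its ingredients are: cuspidality, supports and their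
cardinalities, linear equivalence).  [cite: MochizukiEtTh2009, Prop 5.3 proof p.326 (PDF p.100)] -/
theorem isCuspidallyMinimal_gpMap_iff (hc : ∀ 𝔭, 𝔓.IsCuspidal (Primes.congr ψ 𝔭) ↔ 𝔓.IsCuspidal 𝔭)
    (hP : ∀ x, ThetaFrobenioid.gpMap ψ.toMonoidHom x ∈ 𝔖.principal ↔ x ∈ 𝔖.principal)
    (x : Algebra.GrothendieckGroup 𝔉.PhiAcirc) :
    𝔖.IsCuspidallyMinimal (ThetaFrobenioid.gpMap ψ.toMonoidHom x) ↔ 𝔖.IsCuspidallyMinimal x := by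
  constructor
  · rintro ⟨h1, h2, h3⟩
    refine ⟨(𝔖.isCuspidalGp_gpMap_iff ψ hc x).mp h1, (𝔖.finite_supp_gpMap_iff ψ x).mp h2, fun y hy hyx => ?_⟩
    have := h3 (ThetaFrobenioid.gpMap ψ.toMonoidHom y) ((𝔖.isCuspidalGp_gpMap_iff ψ hc y).mpr hy)
      ((𝔖.linEquiv_gpMap_iff ψ hP y x).mpr hyx)
    rwa [ncard_supp_gpMap, ncard_supp_gpMap] at this
  · rintro ⟨h1, h2, h3⟩
    refine ⟨(𝔖.isCuspidalGp_gpMap_iff ψ hc x).mpr h1, (𝔖.finite_supp_gpMap_iff ψ x).mpr h2, fun y hy hyx => ?_⟩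
    rw [← gpMap_gpMap_symm ψ y] at hy hyx ⊢
    have := h3 _ ((𝔖.isCuspidalGp_gpMap_iff ψ hc _).mp hy) ((𝔖.linEquiv_gpMap_iff ψ hP _ x).mp hyx)
    rwa [ncard_supp_gpMap, ncard_supp_gpMap]

end DivisorSupportData

/-! ### Proposition 5.3 (v) from the printed adjacency criterion -/

section Labels

variable {C : Type u} [Category.{v} C] {D : Type u'} [Category.{v'} D] {𝔉 : ThetaFrobenioid.{w} C D}
  {𝔓 : DivisorPrimeData 𝔉} (𝔖 : DivisorSupportData 𝔓) (Ψ : C ≌ C) (ι : Ψ.functor.obj 𝔉.Acirc ≅ 𝔉.Acirc)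
  (e : 𝔉.PhiAcirc ≃* 𝔉.pre.Mon (𝔉.base.obj (Ψ.functor.obj 𝔉.Acirc)))

/-- **The adjacency of non-cuspidal primes is preserved by `Ψ^Φ_{A_⊚}`** — the step "it suffices to show that the
relation of adjacency … is preserved. But this follows … by observing that if `a ∈ 𝔭`, `b ∈ 𝔮` correspond via the
natural isomorphisms of (ii), then `𝔭, 𝔮` are adjacent … if and only if every cuspidally minimal `c` … linearly
equivalent to `a + b` has support of cardinality `4`" (p.327 (PDF p.101)), PROVED from: the criterion
(`AdjacencyCriterion`), Prop. 5.3 (i) on primes (`hc`), the preservation of principal elements (`hP`, [FrdI]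
Thm. 4.9 / Cor. 4.10), and monoid type `ℤ` (`hN`, for the compatibility with the isomorphisms of (ii),
`Sec5Prop53.apply_componentIso_eq`).  [cite: MochizukiEtTh2009, Prop 5.3 proof p.327 (PDF p.101)] -/
theorem adjacency_preserved_of_criterion (hc : CuspPreserved 𝔓 Ψ ι e)
    (hN : ∀ 𝔭 : Primes 𝔉.PhiAcirc, Nonempty (𝔭.submonoid ≃* Multiplicative ℕ))
    (hP : ∀ x, ThetaFrobenioid.gpMap (psiPhi 𝔉 Ψ ι e).toMonoidHom x ∈ 𝔖.principal ↔ x ∈ 𝔖.principal)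
    (hAdj : AdjacencyCriterion 𝔖) (𝔭 𝔮 : Primes 𝔉.PhiAcirc) (h𝔭 : ¬ 𝔓.IsCuspidal 𝔭) (h𝔮 : ¬ 𝔓.IsCuspidal 𝔮)
    (hadj : |𝔓.ncspEquivZ ⟨𝔭, h𝔭⟩ - 𝔓.ncspEquivZ ⟨𝔮, h𝔮⟩| = 1) :
    |𝔓.ncspEquivZ ⟨Primes.congr (psiPhi 𝔉 Ψ ι e) 𝔭, fun h => h𝔭 ((hc 𝔭).mp h)⟩ -
        𝔓.ncspEquivZ ⟨Primes.congr (psiPhi 𝔉 Ψ ι e) 𝔮, fun h => h𝔮 ((hc 𝔮).mp h)⟩| = 1 := by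
  set ψ := psiPhi 𝔉 Ψ ι e with hψ
  have hne : 𝔭 ≠ 𝔮 := by
    rintro rfl
    rw [sub_self, abs_zero] at hadj
    exact zero_ne_one hadj
  have h𝔭' : ¬ 𝔓.IsCuspidal (Primes.congr ψ 𝔭) := fun h => h𝔭 ((hc 𝔭).mp h)
  have h𝔮' : ¬ 𝔓.IsCuspidal (Primes.congr ψ 𝔮) := fun h => h𝔮 ((hc 𝔮).mp h)
  have hne' : Primes.congr ψ 𝔭 ≠ Primes.congr ψ 𝔮 := fun h => hne ((Primes.congr ψ).injective h)
  -- `a := gen_𝔭 ∈ 𝔭`, `b :=` its correspondent in `𝔮` under (ii)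
  let a : 𝔭.submonoid := ⟨𝔖.gen 𝔭, Submonoid.subset_closure (𝔖.gen_mem_carrier 𝔭)⟩
  have ha : (a : 𝔉.PhiAcirc) ∈ 𝔭.carrier := 𝔖.gen_mem_carrier 𝔭
  have H4 := (hAdj 𝔭 𝔮 h𝔭 h𝔮 hne a ha).1.mp hadj
  -- the transported elements `ψ a ∈ ψ𝔭` and its correspondent, which is `ψ b` by (ii)
  let a' : (Primes.congr ψ 𝔭).submonoid := Primes.submonoidCongr ψ 𝔭 _ rfl a
  have ha' : (a' : 𝔉.PhiAcirc) ∈ (Primes.congr ψ 𝔭).carrier := by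
    rw [Primes.coe_submonoidCongr_apply, Primes.carrier_congr]
    exact ⟨_, ha, rfl⟩
  have hb' : (𝔓.ncspIso _ _ h𝔭' h𝔮' a' : 𝔉.PhiAcirc) = ψ (𝔓.ncspIso 𝔭 𝔮 h𝔭 h𝔮 a : 𝔉.PhiAcirc) :=
    (apply_componentIso_eq ψ hN 𝔭 𝔮 (𝔓.ncspIso 𝔭 𝔮 h𝔭 h𝔮) (𝔓.ncspIso _ _ h𝔭' h𝔮') a).symm
  refine (hAdj _ _ h𝔭' h𝔮' hne' a' ha').1.mpr fun c' hc' hlin => ?_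
  -- pull `c'` back along `ψ^gp`
  have hcc : ThetaFrobenioid.gpMap ψ.toMonoidHom (ThetaFrobenioid.gpMap ψ.symm.toMonoidHom c') = c' :=
    DivisorSupportData.gpMap_gpMap_symm ψ c'
  rw [← hcc] at hc' hlin ⊢
  change (suppOf 𝔖.factor _).ncard = 4
  rw [𝔖.ncard_supp_gpMap]
  refine H4 _ ((𝔖.isCuspidallyMinimal_gpMap_iff ψ hc hP _).mp hc') ?_
  have hab : Algebra.GrothendieckGroup.of (a' : 𝔉.PhiAcirc) *
      Algebra.GrothendieckGroup.of (𝔓.ncspIso _ _ h𝔭' h𝔮' a' : 𝔉.PhiAcirc) =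
      ThetaFrobenioid.gpMap ψ.toMonoidHom (Algebra.GrothendieckGroup.of (a : 𝔉.PhiAcirc) *
        Algebra.GrothendieckGroup.of (𝔓.ncspIso 𝔭 𝔮 h𝔭 h𝔮 a : 𝔉.PhiAcirc)) := by
    rw [map_mul, ThetaFrobenioid.gpMap_of, ThetaFrobenioid.gpMap_of, hb', Primes.coe_submonoidCongr_apply,
      MulEquiv.coe_toMonoidHom]
  rw [hab] at hlin
  exact (𝔖.linEquiv_gpMap_iff ψ hP _ _).mp hlin

/-- **[EtTh] Proposition 5.3 (v), PROVED modulo (i), F1-Ψ and the printed adjacency criterion**: `Ψ^Φ_{A_⊚}`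
preserves "the natural bijection `Prime(Φ(A_⊚))^ncsp ⥲ ℤ` [up to translation … and multiplication by `±1`]" (p.325
(PDF p.99)) — from `adjacency_preserved_of_criterion` and this seat's reduction to adjacency
(`Sec5Prop53.preservesNcspLabels_of_adjacency`, the rigidity `i ↦ ±i + c` of the chain `ℤ`).
[cite: MochizukiEtTh2009, Prop 5.3 (v) p.325 (PDF p.99); proof p.327 (PDF p.101)] -/
theorem preservesNcspLabels_of_adjacencyCriterion (hc : CuspPreserved 𝔓 Ψ ι e)
    (hN : ∀ 𝔭 : Primes 𝔉.PhiAcirc, Nonempty (𝔭.submonoid ≃* Multiplicative ℕ))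
    (hP : ∀ x, ThetaFrobenioid.gpMap (psiPhi 𝔉 Ψ ι e).toMonoidHom x ∈ 𝔖.principal ↔ x ∈ 𝔖.principal)
    (hAdj : AdjacencyCriterion 𝔖) : PreservesNcspLabels 𝔓 Ψ ι e hc :=
  preservesNcspLabels_of_adjacency 𝔓 Ψ ι e hc fun 𝔭 𝔮 h𝔭 h𝔮 h =>
    adjacency_preserved_of_criterion 𝔖 Ψ ι e hc hN hP hAdj 𝔭 𝔮 h𝔭 h𝔮 h

end Labels

end FrobenioidThetaDivisors

end Literature.AnabelianGeometry.EtaleTheta
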